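import Mathlib
import Summits.KontsevichZagierPeriods.KontsevichZagierPeriods.Theorems.SoloInformedIntegrabilityLocus
import Summits.KontsevichZagierPeriods.KontsevichZagierPeriods.Theorems.SoloInformedParamAdmDef
import HarnessLib

/-!
# Solo-informed (A390-ii): the integrability locus of a parametrised term is `ℚ`-semialgebraic

File F6a — LEMMA I transported to the parameter coordinates of the real-parameter kernel.  For a
parametrised term `T : SoloInformedPTerm K d` (a `ℚ`-semialgebraic domain family `T.S ⊆ ℝ^{K ⊕ d}`
and graph family `T.G ⊆ ℝ^{K ⊕ (d+1)}`), the set of parameters `p ∈ ℝ^K` at which the graph fibre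
is the graph of a function AND the resulting integrand is absolutely integrable on the domain
fibre is `ℚ`-semialgebraic (`isSemialgebraic_setOf_functional_integrableOn`), conditional on the
Lion–Rolin preparation fact through `soloInformed_integrableLocus`.

The transport flattens the parameter block along `e : K ≃ Fin k` (`soloFlatIdx`), restricts the
domain family to its functional points (`SoloInformedFunctionalPt`, a first-order condition) and
reads the integrand off the graph family (`soloGvalPt`), so that KERNEL LEMMA I applies to the
flat family `(soloFlatSet, soloFlatVal)`; at a functional parameter its fibre integrand is the
extension by zero of the hybrid integrand (`flat_indicator_eq`).
-/

noncomputable section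

open MeasureTheory Set
open Literature.ModelTheory.ExponentialFields Literature.NumberTheory.Transcendental

namespace Summit.KontsevichZagierPeriods.KontsevichZagierPeriods.Theorems

namespace SoloInformedPTerm

variable {K : Type} {d k : ℕ}

/-! ### Flat coordinates -/

/-- The flat re-indexing `K ⊕ Fin d → Fin (k + d)` along `e : K ≃ Fin k`.
[cite: BochnakCosteRoy1998, §2.2] -/
def soloFlatIdx (e : K ≃ Fin k) (d : ℕ) : K ⊕ Fin d → Fin (k + d) :=
  fun s => finSumFinEquiv (Sum.map e id s)

/-- In flat coordinates `(t, x)` is the point `(t ∘ e, x)`. [cite: BochnakCosteRoy1998, §2.2] -/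
theorem append_comp_flatIdx (e : K ≃ Fin k) (t : Fin k → ℝ) (x : Fin d → ℝ) :
    Fin.append t x ∘ soloFlatIdx e d = Sum.elim (t ∘ e) x := by
  funext s
  rcases s with κ | i
  · simp [soloFlatIdx, Fin.append_left]
  · simp [soloFlatIdx, Fin.append_right]

/-- The flat re-indexing of graph points `K ⊕ Fin (d + 1) → Fin (k + d + 1)`: the last coordinate
is the value. [cite: BochnakCosteRoy1998, §2.2] -/
def soloFlatGraphIdx (e : K ≃ Fin k) (d : ℕ) : K ⊕ Fin (d + 1) → Fin (k + d + 1) :=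
  Sum.elim (Fin.castSucc ∘ soloFlatIdx e d) (fun _ : Fin 1 => Fin.last (k + d)) ∘
    soloSnocIdx K d 1 0

/-- What `soloFlatGraphIdx` does. [cite: BochnakCosteRoy1998, §2.2] -/
theorem comp_flatGraphIdx (e : K ≃ Fin k) (z : Fin (k + d + 1) → ℝ) :
    z ∘ soloFlatGraphIdx e d =
      Sum.elim (Fin.init z ∘ soloFlatIdx e d) (fun _ : Fin 1 => z (Fin.last (k + d))) ∘
        soloSnocIdx K d 1 0 := by
  have hρ : z ∘ Sum.elim (Fin.castSucc ∘ soloFlatIdx e d) (fun _ : Fin 1 => Fin.last (k + d)) =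
      Sum.elim (Fin.init z ∘ soloFlatIdx e d) (fun _ : Fin 1 => z (Fin.last (k + d))) := by
    funext s
    rcases s with v | u <;> rfl
  rw [soloFlatGraphIdx, ← Function.comp_assoc, hρ]

/-! ### Functional points and graph values of the domain family -/

/-- The domain family is functional AT THE POINT `v = (p, x)`: exactly one graph point over it
(block form). [cite: BochnakCosteRoy1998, Def. 2.2.5] -/
def SoloInformedFunctionalPt (T : SoloInformedPTerm K d) (v : K ⊕ Fin d → ℝ) : Prop :=
  (∃ zz : Fin 1 → ℝ, Sum.elim v zz ∘ soloSnocIdx K d 1 0 ∈ T.G) ∧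
    ∀ w : Fin 2 → ℝ, Sum.elim v w ∘ soloSnocIdx K d 2 0 ∈ T.G →
      Sum.elim v w ∘ soloSnocIdx K d 2 1 ∈ T.G → w 0 = w 1

/-- Functionality at `(p, x)` in fibre language. [cite: BochnakCosteRoy1998, Def. 2.2.5] -/
theorem functionalPt_sumElim_iff (T : SoloInformedPTerm K d) (p : K → ℝ) (x : Fin d → ℝ) :
    T.SoloInformedFunctionalPt (Sum.elim p x) ↔
      (∃ t : ℝ, Fin.snoc x t ∈ T.gfibre p) ∧
        ∀ t t' : ℝ, Fin.snoc x t ∈ T.gfibre p → Fin.snoc x t' ∈ T.gfibre p → t = t' := by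
  unfold SoloInformedFunctionalPt
  simp only [comp_snocIdx_mem_iff]
  refine and_congr ?_ ?_
  · exact ⟨fun ⟨zz, h⟩ => ⟨zz 0, h⟩, fun ⟨t, ht⟩ => ⟨fun _ => t, ht⟩⟩
  · refine ⟨fun h t t' ht ht' => ?_, fun h w h0 h1 => h _ _ h0 h1⟩
    have := h ![t, t'] (by simpa using ht) (by simpa using ht')
    simpa using this

/-- Functionality at a parameter is functionality at every point of the fibre.
[cite: BochnakCosteRoy1998, Def. 2.2.5] -/
theorem functional_iff_functionalPt (T : SoloInformedPTerm K d) (p : K → ℝ) :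
    T.SoloInformedFunctional p ↔ ∀ x ∈ T.fibre p, T.SoloInformedFunctionalPt (Sum.elim p x) :=
  forall₂_congr fun x _ => (functionalPt_sumElim_iff T p x).symm

/-- The functional part of the domain family is `ℚ`-semialgebraic.
[cite: BochnakCosteRoy1998, Prop. 2.2.4] -/
theorem isSemialgebraic_setOf_mem_functionalPt [Finite K] (T : SoloInformedPTerm K d) :
    IsSemialgebraic ℚ {v : K ⊕ Fin d → ℝ | v ∈ T.S ∧ T.SoloInformedFunctionalPt v} := by
  have hE : IsSemialgebraic ℚ {u : (K ⊕ Fin d) ⊕ Fin 1 → ℝ | u ∘ soloSnocIdx K d 1 0 ∈ T.G} :=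
    T.hG.preimage_comp _
  have hU : IsSemialgebraic ℚ {u : (K ⊕ Fin d) ⊕ Fin 2 → ℝ |
      u ∘ soloSnocIdx K d 2 0 ∈ T.G → u ∘ soloSnocIdx K d 2 1 ∈ T.G →
        u (Sum.inr 0) = u (Sum.inr 1)} :=
    soloInformed_isSemialgebraic_setOf_imp (T.hG.preimage_comp _)
      (soloInformed_isSemialgebraic_setOf_imp (T.hG.preimage_comp _)
        (soloInformed_isSemialgebraic_setOf_coord_eq _ _))
  exact soloInformed_isSemialgebraic_setOf_and T.hS
    (soloInformed_isSemialgebraic_setOf_and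
      (soloInformed_isSemialgebraic_setOf_exists_block hE fun _ => Iff.rfl)
      (soloInformed_isSemialgebraic_setOf_forall_block hU fun _ => Iff.rfl))

/-- The graph value read off the graph family at the point `v = (p, x)`.
[cite: BochnakCosteRoy1998, §2.2] -/
def soloGvalPt (T : SoloInformedPTerm K d) (v : K ⊕ Fin d → ℝ) : ℝ :=
  Classical.epsilon fun t : ℝ => Sum.elim v (fun _ : Fin 1 => t) ∘ soloSnocIdx K d 1 0 ∈ T.G

/-- At `v = (p, x)` the graph value is `T.gval p x`. [cite: BochnakCosteRoy1998, §2.2] -/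
theorem gvalPt_sumElim (T : SoloInformedPTerm K d) (p : K → ℝ) (x : Fin d → ℝ) :
    T.soloGvalPt (Sum.elim p x) = T.gval p x := by
  unfold soloGvalPt SoloInformedPTerm.gval
  exact congrArg Classical.epsilon
    (funext fun t => propext (comp_snocIdx_mem_iff T p x (fun _ => t) 0))

/-! ### The flat family and LEMMA I -/

/-- The flat family: functional points of the domain family, in flat coordinates.
[cite: BochnakCosteRoy1998, §2.2] -/
def soloFlatSet (T : SoloInformedPTerm K d) (e : K ≃ Fin k) : Set (Fin (k + d) → ℝ) :=
  (fun w => w ∘ soloFlatIdx e d) ⁻¹' {v | v ∈ T.S ∧ T.SoloInformedFunctionalPt v}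

/-- The flat integrand: the graph value in flat coordinates. [cite: BochnakCosteRoy1998, §2.2] -/
def soloFlatVal (T : SoloInformedPTerm K d) (e : K ≃ Fin k) : (Fin (k + d) → ℝ) → ℝ :=
  fun w => T.soloGvalPt (w ∘ soloFlatIdx e d)

/-- Membership in the flat family. [cite: BochnakCosteRoy1998, §2.2] -/
theorem mem_flatSet_iff (T : SoloInformedPTerm K d) (e : K ≃ Fin k) (w : Fin (k + d) → ℝ) :
    w ∈ T.soloFlatSet e ↔
      w ∘ soloFlatIdx e d ∈ T.S ∧ T.SoloInformedFunctionalPt (w ∘ soloFlatIdx e d) :=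
  Iff.rfl

/-- The flat family is `ℚ`-semialgebraic. [cite: BochnakCosteRoy1998, Prop. 2.2.4] -/
theorem isSemialgebraic_flatSet [Finite K] (T : SoloInformedPTerm K d) (e : K ≃ Fin k) :
    IsSemialgebraic ℚ (T.soloFlatSet e) :=
  (isSemialgebraic_setOf_mem_functionalPt T).preimage_comp _

/-- The flat integrand is a `ℚ`-semialgebraic function on the flat family: its graph is cut out
by the graph family. [cite: BochnakCosteRoy1998, Prop. 2.2.4] -/
theorem isSemialgebraicFunOn_flatVal [Finite K] (T : SoloInformedPTerm K d) (e : K ≃ Fin k) :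
    IsSemialgebraicFunOn ℚ (T.soloFlatSet e) (T.soloFlatVal e) := by
  rw [isSemialgebraicFunOn_iff]
  have hset : {z : Fin (k + d + 1) → ℝ | Fin.init z ∈ T.soloFlatSet e ∧
      z (Fin.last (k + d)) = T.soloFlatVal e (Fin.init z)} =
      {z : Fin (k + d + 1) → ℝ | Fin.init z ∈ T.soloFlatSet e} ∩
        (fun z => z ∘ soloFlatGraphIdx e d) ⁻¹' T.G := by
    ext z
    simp only [mem_setOf_eq, mem_inter_iff, mem_preimage]
    refine and_congr_right fun hz => ?_
    obtain ⟨p, x, hv⟩ : ∃ (p : K → ℝ) (x : Fin d → ℝ), Fin.init z ∘ soloFlatIdx e d = Sum.elim p x :=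
      ⟨_, _, (Sum.elim_comp_inl_inr _).symm⟩
    have hfun : T.SoloInformedFunctionalPt (Sum.elim p x) := by
      have h := (mem_flatSet_iff T e _).mp hz
      rw [hv] at h
      exact h.2
    rw [functionalPt_sumElim_iff] at hfun
    rw [comp_flatGraphIdx, hv, comp_snocIdx_mem_iff, soloFlatVal, hv, gvalPt_sumElim]
    constructor
    · intro h
      rw [h]
      exact gval_spec hfun.1
    · intro h
      exact hfun.2 _ _ h (gval_spec hfun.1)
  rw [hset]
  exact (isSemialgebraic_flatSet T e).setOf_init_mem.inter (T.hG.preimage_comp _)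

/-- At a functional parameter, the fibre integrand of the flat family over `t = p ∘ e⁻¹` is the
extension by zero of the hybrid integrand. [cite: KontsevichZagier2001, §1.1] -/
theorem flat_indicator_eq {T : SoloInformedPTerm K d} {p : K → ℝ} (hf : T.SoloInformedFunctional p)
    (e : K ≃ Fin k) :
    (fun x : Fin d → ℝ => (T.soloFlatSet e).indicator (T.soloFlatVal e) (Fin.append (p ∘ e.symm) x)) =
      (T.fibre p).indicator (T.hybrid p) := by
  have happ : ∀ x : Fin d → ℝ, Fin.append (p ∘ e.symm) x ∘ soloFlatIdx e d = Sum.elim p x :=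
    fun x => by
      rw [append_comp_flatIdx]
      congr 1
      funext κ
      simp
  funext x
  by_cases hx : x ∈ T.fibre p
  · have hmem : Fin.append (p ∘ e.symm) x ∈ T.soloFlatSet e := by
      rw [mem_flatSet_iff, happ]
      exact ⟨hx, (functional_iff_functionalPt T p).mp hf x hx⟩
    rw [indicator_of_mem hmem, indicator_of_mem hx, hybrid_of_mem hx, soloFlatVal, happ,
      gvalPt_sumElim]
  · have hmem : Fin.append (p ∘ e.symm) x ∉ T.soloFlatSet e := fun h => by
      rw [mem_flatSet_iff, happ] at h
      exact hx h.1
    rw [indicator_of_notMem hmem, indicator_of_notMem hx]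

/-- **The functional-and-integrable locus of a parametrised term is `ℚ`-semialgebraic**
(conditional on the Lion–Rolin preparation fact): KERNEL LEMMA I in parameter coordinates.
[cite: ComteLionRolin2000, Thm. 3] [cite: KontsevichZagier2001, §1.1] -/
theorem isSemialgebraic_setOf_functional_integrableOn (hprep : semialgebraicPreparation)
    [Finite K] (T : SoloInformedPTerm K d) :
    IsSemialgebraic ℚ {p : K → ℝ |
      T.SoloInformedFunctional p ∧ IntegrableOn (T.hybrid p) (T.fibre p)} := by
  classical
  haveI := Fintype.ofFinite K
  have hL := soloInformed_integrableLocus hprep (k := Fintype.card K) (m := d)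
    (isSemialgebraic_flatSet T (Fintype.equivFin K))
    (isSemialgebraicFunOn_flatVal T (Fintype.equivFin K))
  have hset : {p : K → ℝ | T.SoloInformedFunctional p ∧ IntegrableOn (T.hybrid p) (T.fibre p)} =
      {p | T.SoloInformedFunctional p} ∩
        (fun p : K → ℝ => p ∘ (Fintype.equivFin K).symm) ⁻¹' {t : Fin (Fintype.card K) → ℝ |
          Integrable (fun x : Fin d → ℝ => (T.soloFlatSet (Fintype.equivFin K)).indicator
            (T.soloFlatVal (Fintype.equivFin K)) (Fin.append t x))} := by
    ext p
    simp only [mem_setOf_eq, mem_inter_iff, mem_preimage]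
    refine and_congr_right fun hf => ?_
    rw [flat_indicator_eq hf, integrable_indicator_iff (T.measurableSet_fibre p)]
  rw [hset]
  exact (isSemialgebraic_setOf_functional T).inter (hL.preimage_comp _)

end SoloInformedPTerm

end Summit.KontsevichZagierPeriods.KontsevichZagierPeriods.Theorems
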